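import Literature.Barriers.QuantumFields.FiniteTemperatureReflection
import Literature.RepresentationTheory.CompactGroups.UnitaryTrick
import HarnessLib

/-!
# The one-link integral of Wilson's action in a unitary representation: Hermitian, non-degenerate for `β > 0`

Topic `Literature/MathematicalPhysics/QuantumFieldTheory`.  Two definitions with bodies and their elementary theory;
no named facts.

AS PRINTED.  I. Montvay, G. Münster, *Quantum Fields on a Lattice* (1994) §3.2.7 (3.170)–(3.173) and §3.2.8
(3.184)–(3.187) (PDF pp. 128–129): each (temporal) plaquette contributes a factor `exp −S_p(U)` to the Boltzmann factor;
in the temporal gauge the cross-slice term is a product of ONE-LINK factors `exp(β/N Re Tr U'⁺U)` ((3.184)), whose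
character expansion `exp −S_p(U) = Σ_r d_r c_r(β) χ_r(U)` ((3.171)) has the coefficients
`d_r c_r = ∫ dU conj χ_r(U) e^{−S_p(U)}` ((3.187)), real and — by the non-negativity of
`∫ dU conj χ_r(U) (Tr U)^m (Tr U⁺)^n` — non-negative; for `U(1)` and `SU(2)` they are Bessel functions ((3.172)–(3.173)).
M. Creutz, *Quarks, Gluons and Lattices* (1983/2022) ch. 8 (group integration).  Here, for a compact group `G`, a
continuous unitary `ρ : G →* U(N)` and the Wilson one-link weight

* `oneLinkWeight ρ β g = exp(−β (N − Re tr ρ(g)))` (the Boltzmann factor of ONE temporal plaquette in temporal gauge,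
  as a function of the product `g = U U'⁻¹` of the two spatial links it contains), and
* `oneLinkMatrix ρ β = ∫ oneLinkWeight ρ β (g) · ρ(g) dg ∈ M_N(ℂ)` (entrywise Haar integrals: the `ρ`-block of the
  expansion (3.171); for irreducible `ρ` it is the scalar `c_ρ(β)·1` of (3.187) by Schur's lemma — not used here),

we PROVE, without any character theory:

* `oneLinkWeight_pos/_inv/_one/_le_one`, `continuous_oneLinkWeight`, `integral_oneLinkWeight_pos`,
  `integral_oneLinkWeight_mul_inv` (translation invariance);
* `integral_re_trace_rep_nonneg` — **`∫ Re tr ρ(g) dg ≥ 0`** (the Haar average `P = ∫ ρ` is a self-adjoint idempotent,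
  so `Re tr P = Σ |P_ij|²`; Bröcker–tom Dieck II (4.11)(i) `∫ χ = dim V^G` is the tree's
  `Schur.finrank_invariants_eq_integral_character`, in another typing);
* `oneLinkMatrix_conjTranspose` — **`M(β)` is Hermitian** (unitarity, `f(g⁻¹) = f(g)`, inversion invariance of Haar measure);
* `re_trace_oneLinkMatrix_eq`, ★ `re_trace_oneLinkMatrix_pos` — **`Re tr M(β) = ∫ f_β Re χ_ρ > 0` for `β > 0`, `N ≥ 1`**
  (pointwise `e^{βt} t ≥ t + (e^{βt} − 1) t` with `(e^{βt} − 1) t ≥ 0`, strictly positive near `g = 1`, plus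
  `∫ Re χ_ρ ≥ 0`); hence `oneLinkMatrix_ne_zero`;
* `integral_oneLinkWeight_mul_trace_mul_rep` — `∫ f_β(g) tr(B ρ(g)) dg = tr(B M(β))`;
  `integral_oneLinkWeight_mul_inv_mul_rep_apply` — `∫ f_β(a x⁻¹) ρ(x)_{ij} dx = (M(β) ρ(a))_{ij}` (the link carrying `a`);
* ★ `exists_trace_oneLinkMatrix_pow_mul_rep_ne_zero` — for `β > 0`, `N ≥ 1` and EVERY `n`, the class-like function
  `g ↦ tr(M(β)^n ρ(g))` is not identically zero (even `n`: `tr M^{2k} = ‖M^k‖²_F > 0` for the non-zero Hermitian `M`;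
  odd `n`: its `f_β`-average is `tr M^{n+1} > 0`).  This is the group-theoretic input of
  `WilsonFinTorusFluxSectorsPopulated.lean` (every unit electric flux of a finite box is populated).

HONEST FRAMING: single-link group integrals; nothing here is about a lattice, a volume or a gap.

References: Montvay–Münster 1994 §3.2.7–§3.2.8; Creutz, *Quarks, Gluons and Lattices* ch. 8; T. Bröcker, T. tom Dieck,
*Representations of Compact Lie Groups* (1985) II (4.1), (4.11).
-/

noncomputable section

open MeasureTheory Filter
open scoped ComplexConjugate BigOperators Matrix
open Literature.Barriers.QuantumFields Literature.RepresentationTheory.CompactGroups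

namespace Literature.MathematicalPhysics.QuantumFieldTheory

variable {G : Type*} [Group G] [TopologicalSpace G] [IsTopologicalGroup G] [CompactSpace G]
  [MeasurableSpace G] [BorelSpace G] {N : ℕ} (ρ : G →* Matrix (Fin N) (Fin N) ℂ)

/-! ### The one-link weight -/

/-- **The Wilson one-link weight** `f_β(g) = exp(−β (N − Re tr ρ(g)))`: the Boltzmann factor `exp −S_p` of one temporal
plaquette in the temporal gauge, as a function of the product `g = U_{x,i} U'_{x,i}⁻¹` of its two spatial links
(Montvay–Münster (3.170), (3.184)). [cite: MontvayMunster1994, §3.2.7 (3.170) and §3.2.8 (3.184)] -/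
def oneLinkWeight (β : ℝ) (g : G) : ℝ :=
  Real.exp (-(β * ((N : ℝ) - (ρ g).trace.re)))

omit [TopologicalSpace G] [IsTopologicalGroup G] [CompactSpace G] [MeasurableSpace G] [BorelSpace G] in
/-- Unfolding lemma. [cite: MontvayMunster1994, §3.2.7 (3.170)] -/
theorem oneLinkWeight_def (β : ℝ) (g : G) :
    oneLinkWeight ρ β g = Real.exp (-(β * ((N : ℝ) - (ρ g).trace.re))) := rfl

omit [TopologicalSpace G] [IsTopologicalGroup G] [CompactSpace G] [MeasurableSpace G] [BorelSpace G] in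
/-- The one-link weight is strictly positive. [cite: MontvayMunster1994, §3.2.7 (3.170)] -/
theorem oneLinkWeight_pos (β : ℝ) (g : G) : 0 < oneLinkWeight ρ β g := Real.exp_pos _

omit [TopologicalSpace G] [IsTopologicalGroup G] [CompactSpace G] [MeasurableSpace G] [BorelSpace G] in
/-- At the identity the weight is `1` (`Re tr ρ(1) = N`). [cite: MontvayMunster1994, §3.2.7 (3.170)] -/
theorem oneLinkWeight_one (β : ℝ) : oneLinkWeight ρ β (1 : G) = 1 := by
  rw [oneLinkWeight_def, map_one, Matrix.trace_one, Fintype.card_fin]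
  simp

omit [IsTopologicalGroup G] [CompactSpace G] [MeasurableSpace G] [BorelSpace G] in
/-- The one-link weight is continuous (continuous `ρ`). [cite: MontvayMunster1994, §3.2.7 (3.170)] -/
theorem continuous_oneLinkWeight (hρ : Continuous ρ) (β : ℝ) : Continuous (oneLinkWeight ρ β) :=
  Real.continuous_exp.comp (continuous_const.mul (continuous_const.sub
    (Complex.continuous_re.comp hρ.matrix_trace))).neg

omit [MeasurableSpace G] [BorelSpace G] in
/-- `f_β(g⁻¹) = f_β(g)` (`Re tr ρ(g⁻¹) = Re tr ρ(g)` for a continuous representation of a compact group).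
[cite: MontvayMunster1994, §3.2.8 (3.184)–(3.185)] -/
theorem oneLinkWeight_inv (hρ : Continuous ρ) (β : ℝ) (g : G) : oneLinkWeight ρ β g⁻¹ = oneLinkWeight ρ β g := by
  rw [oneLinkWeight_def, oneLinkWeight_def, CompactGroup.re_trace_map_inv ρ hρ]

omit [MeasurableSpace G] [BorelSpace G] in
/-- `f_β ≤ 1` for `β ≥ 0` (`Re tr ρ(g) ≤ N`). [cite: MontvayMunster1994, §3.2.2 (3.67)] -/
theorem oneLinkWeight_le_one (hρ : Continuous ρ) {β : ℝ} (hβ : 0 ≤ β) (g : G) : oneLinkWeight ρ β g ≤ 1 := by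
  rw [oneLinkWeight_def, Real.exp_le_one_iff, neg_nonpos]
  refine mul_nonneg hβ (sub_nonneg.2 ?_)
  have h := CompactGroup.abs_re_trace_le_card ρ hρ g
  rw [Fintype.card_fin] at h
  exact (le_abs_self _).trans h

/-- Continuous functions on the compact group are Haar integrable (plumbing). [folklore] -/
private theorem integrable_of_continuous' {E : Type*} [NormedAddCommGroup E] {f : G → E} (hf : Continuous f) :
    Integrable f (haarProbability G) :=
  hf.integrable_of_hasCompactSupport (HasCompactSupport.of_compactSpace f)

/-- `∫ f_β > 0`. [cite: MontvayMunster1994, §3.2.7 (3.171)] -/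
theorem integral_oneLinkWeight_pos (hρ : Continuous ρ) (β : ℝ) : 0 < ∫ g, oneLinkWeight ρ β g ∂haarProbability G :=
  integral_exp_pos (integrable_of_continuous' (continuous_oneLinkWeight ρ hρ β))

/-- Translation invariance: `∫ f_β(a x⁻¹) dx = ∫ f_β(x) dx`. [cite: MontvayMunster1994, §3.2.8 (3.184)–(3.187)] -/
theorem integral_oneLinkWeight_mul_inv (hρ : Continuous ρ) (β : ℝ) (a : G) :
    ∫ x, oneLinkWeight ρ β (a * x⁻¹) ∂haarProbability G = ∫ x, oneLinkWeight ρ β x ∂haarProbability G := by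
  rw [← integral_mul_right_eq_self (fun x => oneLinkWeight ρ β (a * x⁻¹)) a]
  refine integral_congr_ae (Eventually.of_forall fun x => ?_)
  dsimp only
  rw [mul_inv_rev, ← mul_assoc, mul_inv_cancel, one_mul, oneLinkWeight_inv ρ hρ]

/-! ### The Haar average of a unitary representation is a self-adjoint idempotent: `∫ Re tr ρ ≥ 0` -/

/-- **`∫ Re tr ρ(g) dg ≥ 0`** for a continuous unitary representation of a compact group: the Haar average
`P = ∫ ρ(g) dg` satisfies `P² = P` (left invariance) and `Pᴴ = P` (unitarity and inversion invariance), so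
`tr P = tr(Pᴴ P) = Σ_{ij} |P_{ij}|² ≥ 0` (Bröcker–tom Dieck II (4.1), (4.11)(i): `∫ χ_V = dim V^G`).
[cite: BrockerTomDieck1985, II (4.1) and Thm (4.11)(i)] -/
theorem integral_re_trace_rep_nonneg (hρ : Continuous ρ) (hρu : ∀ g, ρ g ∈ Matrix.unitaryGroup (Fin N) ℂ) :
    0 ≤ ∫ g, (ρ g).trace.re ∂haarProbability G := by
  set μ := haarProbability G with hμ
  set P : Matrix (Fin N) (Fin N) ℂ := Matrix.of fun i j => ∫ g, ρ g i j ∂μ with hP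
  have hPa : ∀ i j, P i j = ∫ g, ρ g i j ∂μ := fun i j => rfl
  have hint : ∀ i j, Integrable (fun g => ρ g i j) μ := fun i j => integrable_of_continuous' (hρ.matrix_elem i j)
  -- `P² = P`
  have hPP : P * P = P := by
    ext i j
    rw [Matrix.mul_apply]
    calc ∑ k, P i k * P k j = ∑ k, ∫ g, ρ g i k * P k j ∂μ := Finset.sum_congr rfl fun k _ => by
            rw [hPa i k, integral_mul_const]
      _ = ∫ g, ∑ k, ρ g i k * P k j ∂μ := (integral_finsetSum _ fun k _ => (hint i k).mul_const _).symm
      _ = ∫ g, ∫ h, ρ (g * h) i j ∂μ ∂μ := by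
            refine integral_congr_ae (Eventually.of_forall fun g => ?_)
            dsimp only
            simp_rw [hPa, ← integral_const_mul]
            rw [← integral_finsetSum _ fun k _ => (hint k j).const_mul _]
            refine integral_congr_ae (Eventually.of_forall fun h => ?_)
            dsimp only
            rw [map_mul, Matrix.mul_apply]
      _ = ∫ g, ∫ h, ρ h i j ∂μ ∂μ := integral_congr_ae (Eventually.of_forall fun g =>
            integral_mul_left_eq_self (fun h => ρ h i j) g)
      _ = P i j := by rw [integral_const, ← hPa]; simp
  -- `Pᴴ = P`
  have hPH : ∀ i j, star (P j i) = P i j := fun i j => by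
    rw [hPa, hPa, Complex.star_def, ← integral_conj]
    have h1 : ∀ g, conj (ρ g j i) = ρ g⁻¹ i j := fun g => by
      rw [FiniteTemperature.rep_inv_eq_star ρ hρu, Matrix.star_eq_conjTranspose, Matrix.conjTranspose_apply,
        Complex.star_def]
    simp_rw [h1]
    exact integral_inv_eq_self (fun g => ρ g i j) μ
  -- `Re tr P = Σ |P_{ij}|²`
  have htr : (P.trace).re = ∑ i, ∑ j, ‖P i j‖ ^ 2 := by
    conv_lhs => rw [← hPP]
    simp only [Matrix.trace, Matrix.diag_apply, Matrix.mul_apply, Complex.re_sum]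
    refine Finset.sum_congr rfl fun i _ => Finset.sum_congr rfl fun j _ => ?_
    rw [← hPH j i, Complex.star_def, Complex.mul_conj, Complex.ofReal_re, Complex.normSq_eq_norm_sq]
  -- `Re tr P = ∫ Re tr ρ`
  have htr' : (P.trace).re = ∫ g, (ρ g).trace.re ∂μ := by
    have h1 : P.trace = ∫ g, (ρ g).trace ∂μ := by
      simp only [Matrix.trace, Matrix.diag_apply, hPa]
      rw [integral_finsetSum _ fun i _ => hint i i]
    have h2 := integral_re (integrable_of_continuous' (hρ.matrix_trace))
    simp only [RCLike.re_to_complex] at h2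
    rw [h1, ← h2]
  rw [← htr', htr]
  exact Finset.sum_nonneg fun i _ => Finset.sum_nonneg fun j _ => sq_nonneg _

/-! ### The one-link matrix -/

/-- **The one-link matrix** `M(β)_{ij} = ∫ f_β(g) ρ(g)_{ij} dg` — the `ρ`-block of the character expansion (3.171) of the
one-link weight (for irreducible `ρ`, Schur's lemma makes it the scalar `c_ρ(β)` of (3.187); not used).
[cite: MontvayMunster1994, §3.2.7 (3.171) and §3.2.8 (3.187)] -/
def oneLinkMatrix (β : ℝ) : Matrix (Fin N) (Fin N) ℂ :=
  Matrix.of fun i j => ∫ g, (oneLinkWeight ρ β g : ℂ) * ρ g i j ∂haarProbability G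

/-- Unfolding lemma. [cite: MontvayMunster1994, §3.2.8 (3.187)] -/
theorem oneLinkMatrix_apply (β : ℝ) (i j : Fin N) :
    oneLinkMatrix ρ β i j = ∫ g, (oneLinkWeight ρ β g : ℂ) * ρ g i j ∂haarProbability G := rfl

/-- The entry integrands are integrable (plumbing). [folklore] -/
private theorem integrable_oneLinkWeight_mul_entry (hρ : Continuous ρ) (β : ℝ) (i j : Fin N) :
    Integrable (fun g => (oneLinkWeight ρ β g : ℂ) * ρ g i j) (haarProbability G) :=
  integrable_of_continuous' ((Complex.continuous_ofReal.comp (continuous_oneLinkWeight ρ hρ β)).mul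
    (hρ.matrix_elem i j))

/-- **The one-link matrix is Hermitian** (`ρ(g)ᴴ = ρ(g⁻¹)`, `f_β(g⁻¹) = f_β(g)`, inversion invariance of Haar measure):
the coefficients (3.187) are real. [cite: MontvayMunster1994, §3.2.8 (3.187)] -/
theorem oneLinkMatrix_conjTranspose (hρ : Continuous ρ) (hρu : ∀ g, ρ g ∈ Matrix.unitaryGroup (Fin N) ℂ) (β : ℝ) :
    (oneLinkMatrix ρ β)ᴴ = oneLinkMatrix ρ β := by
  ext i j
  rw [Matrix.conjTranspose_apply, oneLinkMatrix_apply, oneLinkMatrix_apply, Complex.star_def, ← integral_conj]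
  have h1 : ∀ g, conj ((oneLinkWeight ρ β g : ℂ) * ρ g j i) = (oneLinkWeight ρ β g⁻¹ : ℂ) * ρ g⁻¹ i j := fun g => by
    rw [map_mul, Complex.conj_ofReal, oneLinkWeight_inv ρ hρ, FiniteTemperature.rep_inv_eq_star ρ hρu,
      Matrix.star_eq_conjTranspose, Matrix.conjTranspose_apply, Complex.star_def]
  simp_rw [h1]
  exact integral_inv_eq_self (fun g => (oneLinkWeight ρ β g : ℂ) * ρ g i j) (haarProbability G)

/-- `M(β)` is Hermitian, as a `Matrix.IsHermitian` statement. [cite: MontvayMunster1994, §3.2.8 (3.187)] -/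
theorem isHermitian_oneLinkMatrix (hρ : Continuous ρ) (hρu : ∀ g, ρ g ∈ Matrix.unitaryGroup (Fin N) ℂ) (β : ℝ) :
    (oneLinkMatrix ρ β).IsHermitian :=
  oneLinkMatrix_conjTranspose ρ hρ hρu β

/-- **`Re tr M(β) = ∫ f_β(g) Re tr ρ(g) dg`** (and the trace is real). [cite: MontvayMunster1994, §3.2.8 (3.187)] -/
theorem re_trace_oneLinkMatrix_eq (hρ : Continuous ρ) (β : ℝ) :
    ((oneLinkMatrix ρ β).trace).re = ∫ g, oneLinkWeight ρ β g * (ρ g).trace.re ∂haarProbability G := by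
  have h1 : (oneLinkMatrix ρ β).trace = ∫ g, (oneLinkWeight ρ β g : ℂ) * (ρ g).trace ∂haarProbability G := by
    simp only [Matrix.trace, Matrix.diag_apply, oneLinkMatrix_apply]
    rw [← integral_finsetSum _ fun i _ => integrable_oneLinkWeight_mul_entry ρ hρ β i i]
    refine integral_congr_ae (Eventually.of_forall fun g => ?_)
    dsimp only
    rw [Finset.mul_sum]
  have hI : Integrable (fun g => (oneLinkWeight ρ β g : ℂ) * (ρ g).trace) (haarProbability G) :=
    integrable_of_continuous' ((Complex.continuous_ofReal.comp (continuous_oneLinkWeight ρ hρ β)).mul hρ.matrix_trace)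
  have h2 := integral_re hI
  simp only [RCLike.re_to_complex] at h2
  rw [h1, ← h2]
  refine integral_congr_ae (Eventually.of_forall fun g => ?_)
  simp only [Complex.re_ofReal_mul]

/-- ★ **Non-degeneracy: `Re tr M(β) > 0` for `β > 0` and `N ≥ 1`.**  Pointwise, with `t = Re tr ρ(g)`,
`f_β t = e^{−βN}(t + (e^{βt} − 1) t)` where `(e^{βt} − 1) t ≥ 0` everywhere and `> 0` near `g = 1` (`t(1) = N`);
and `∫ t ≥ 0` (`integral_re_trace_rep_nonneg`).  (For irreducible `ρ` this is `c_ρ(β) > 0`, the positivity of the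
character coefficient of the representation itself, Montvay–Münster after (3.187).)
[cite: MontvayMunster1994, §3.2.8 (3.187)] -/
theorem re_trace_oneLinkMatrix_pos (hρ : Continuous ρ) (hρu : ∀ g, ρ g ∈ Matrix.unitaryGroup (Fin N) ℂ) [NeZero N]
    {β : ℝ} (hβ : 0 < β) : 0 < ((oneLinkMatrix ρ β).trace).re := by
  set μ := haarProbability G with hμ
  set t : G → ℝ := fun g => (ρ g).trace.re with ht
  have htc : Continuous t := Complex.continuous_re.comp hρ.matrix_trace
  rw [re_trace_oneLinkMatrix_eq ρ hρ β]
  have hdec : ∀ g, oneLinkWeight ρ β g * (ρ g).trace.re =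
      Real.exp (-(β * N)) * t g + Real.exp (-(β * N)) * ((Real.exp (β * t g) - 1) * t g) := fun g => by
    rw [oneLinkWeight_def, show -(β * ((N : ℝ) - (ρ g).trace.re)) = -(β * N) + β * t g by simp only [ht]; ring,
      Real.exp_add]
    simp only [ht]
    ring
  simp_rw [hdec]
  have hgc : Continuous fun g => (Real.exp (β * t g) - 1) * t g :=
    ((Real.continuous_exp.comp (continuous_const.mul htc)).sub continuous_const).mul htc
  have hg0 : ∀ g, 0 ≤ (Real.exp (β * t g) - 1) * t g := fun g => by
    rcases le_or_gt 0 (t g) with h | h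
    · exact mul_nonneg (sub_nonneg.2 (Real.one_le_exp (mul_nonneg hβ.le h))) h
    · refine mul_nonneg_of_nonpos_of_nonpos (sub_nonpos.2 ?_) h.le
      exact Real.exp_le_one_iff.2 (mul_nonpos_of_nonneg_of_nonpos hβ.le h.le)
  have hg1 : (Real.exp (β * t 1) - 1) * t 1 ≠ 0 := by
    have ht1 : t 1 = N := by simp [ht, Matrix.trace_one]
    have hN : (0 : ℝ) < N := Nat.cast_pos.2 (Nat.pos_of_ne_zero (NeZero.ne N))
    rw [ht1]
    refine mul_ne_zero (sub_ne_zero.2 ?_) hN.ne'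
    exact (Real.one_lt_exp_iff.2 (mul_pos hβ hN)).ne'
  have hpos : 0 < ∫ g, (Real.exp (β * t g) - 1) * t g ∂μ :=
    hgc.integral_pos_of_hasCompactSupport_nonneg_nonzero (HasCompactSupport.of_compactSpace _) hg0 hg1
  have hnn : 0 ≤ ∫ g, t g ∂μ := integral_re_trace_rep_nonneg ρ hρ hρu
  rw [integral_add ((integrable_of_continuous' htc).const_mul _) ((integrable_of_continuous' hgc).const_mul _),
    integral_const_mul, integral_const_mul]
  have he : 0 < Real.exp (-(β * N)) := Real.exp_pos _
  nlinarith [mul_nonneg he.le hnn, mul_pos he hpos]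

/-- `M(β) ≠ 0` for `β > 0`, `N ≥ 1`. [cite: MontvayMunster1994, §3.2.8 (3.187)] -/
theorem oneLinkMatrix_ne_zero (hρ : Continuous ρ) (hρu : ∀ g, ρ g ∈ Matrix.unitaryGroup (Fin N) ℂ) [NeZero N]
    {β : ℝ} (hβ : 0 < β) : oneLinkMatrix ρ β ≠ 0 := fun h => by
  have h1 := re_trace_oneLinkMatrix_pos ρ hρ hρu hβ
  rw [h, Matrix.trace_zero, Complex.zero_re] at h1
  exact lt_irrefl _ h1

/-! ### Powers of a non-zero Hermitian matrix (plumbing) -/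

/-- `Re tr(Aᴴ A) = Σ |A_{ij}|²`, `Im tr(Aᴴ A) = 0` (plumbing). [folklore] -/
private theorem trace_conjTranspose_mul_self_eq (A : Matrix (Fin N) (Fin N) ℂ) :
    ((Aᴴ * A).trace).re = ∑ i, ∑ j, ‖A j i‖ ^ 2 ∧ ((Aᴴ * A).trace).im = 0 := by
  have h : (Aᴴ * A).trace = ∑ i, ∑ j, (((‖A j i‖ ^ 2 : ℝ)) : ℂ) := by
    simp only [Matrix.trace, Matrix.diag_apply, Matrix.mul_apply, Matrix.conjTranspose_apply, Complex.star_def]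
    refine Finset.sum_congr rfl fun i _ => Finset.sum_congr rfl fun j _ => ?_
    rw [← Complex.normSq_eq_norm_sq, ← Complex.mul_conj, mul_comm]
  rw [h]
  constructor
  · simp only [Complex.re_sum, Complex.ofReal_re]
  · simp only [Complex.im_sum, Complex.ofReal_im, Finset.sum_const_zero]

/-- A non-zero Hermitian matrix has non-zero square (plumbing: `tr(A A) = tr(Aᴴ A) = ‖A‖_F² > 0`). [folklore] -/
private theorem mul_self_ne_zero_of_isHermitian {A : Matrix (Fin N) (Fin N) ℂ} (hA : A.IsHermitian) (h : A ≠ 0) :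
    A * A ≠ 0 := by
  intro h0
  have h1 := (trace_conjTranspose_mul_self_eq A).1
  rw [hA.eq, h0, Matrix.trace_zero, Complex.zero_re] at h1
  apply h
  ext i j
  have h2 : ∀ i ∈ Finset.univ, ∑ j, ‖A j i‖ ^ 2 = 0 :=
    (Finset.sum_eq_zero_iff_of_nonneg fun i _ => Finset.sum_nonneg fun j _ => sq_nonneg _).1 h1.symm
  have h3 := (Finset.sum_eq_zero_iff_of_nonneg fun j _ => sq_nonneg _).1 (h2 j (Finset.mem_univ _)) i
    (Finset.mem_univ _)
  rw [Matrix.zero_apply]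
  exact norm_eq_zero.1 (pow_eq_zero_iff two_ne_zero |>.1 h3)

/-- All powers of a non-zero Hermitian matrix are non-zero (plumbing: `A^{2^j} ≠ 0` by squaring, and
`A^{2^k} = A^k A^{2^k − k}`). [folklore] -/
private theorem pow_ne_zero_of_isHermitian {A : Matrix (Fin N) (Fin N) ℂ} (hA : A.IsHermitian) (h : A ≠ 0)
    (k : ℕ) : A ^ k ≠ 0 := by
  have hsq : ∀ j : ℕ, A ^ (2 ^ j) ≠ 0 := fun j => by
    induction j with
    | zero => simpa using h
    | succ j ih =>
      rw [pow_succ, pow_mul, sq]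
      exact mul_self_ne_zero_of_isHermitian (hA.pow _) ih
  intro hk
  apply hsq k
  rw [← Nat.add_sub_cancel' (Nat.lt_two_pow_self (n := k)).le, pow_add, hk, zero_mul]

/-- `Re tr A^{2k} > 0` (and `Im = 0`) for a non-zero Hermitian matrix (plumbing). [folklore] -/
private theorem re_trace_pow_two_mul_pos {A : Matrix (Fin N) (Fin N) ℂ} (hA : A.IsHermitian) (h : A ≠ 0)
    (k : ℕ) : 0 < ((A ^ (2 * k)).trace).re ∧ ((A ^ (2 * k)).trace).im = 0 := by
  have hk := pow_ne_zero_of_isHermitian hA h k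
  have heq : A ^ (2 * k) = (A ^ k)ᴴ * A ^ k := by rw [(hA.pow k).eq, two_mul, pow_add]
  rw [heq]
  refine ⟨?_, (trace_conjTranspose_mul_self_eq _).2⟩
  rw [(trace_conjTranspose_mul_self_eq _).1]
  by_contra hle
  apply hk
  have h0 : ∑ i, ∑ j, ‖(A ^ k) j i‖ ^ 2 = 0 :=
    le_antisymm (not_lt.1 hle) (Finset.sum_nonneg fun i _ => Finset.sum_nonneg fun j _ => sq_nonneg _)
  ext i j
  have h2 : ∀ i ∈ Finset.univ, ∑ j, ‖(A ^ k) j i‖ ^ 2 = 0 :=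
    (Finset.sum_eq_zero_iff_of_nonneg fun i _ => Finset.sum_nonneg fun j _ => sq_nonneg _).1 h0
  have h3 := (Finset.sum_eq_zero_iff_of_nonneg fun j _ => sq_nonneg _).1 (h2 j (Finset.mem_univ _)) i
    (Finset.mem_univ _)
  rw [Matrix.zero_apply]
  exact norm_eq_zero.1 (pow_eq_zero_iff two_ne_zero |>.1 h3)

/-! ### One-link integrals against the matrix coefficients -/

/-- **`∫ f_β(g) tr(B ρ(g)) dg = tr(B M(β))`** for every matrix `B` (linearity of the entrywise integrals).
[cite: MontvayMunster1994, §3.2.8 (3.185)–(3.187)] -/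
theorem integral_oneLinkWeight_mul_trace_mul_rep (hρ : Continuous ρ) (β : ℝ) (B : Matrix (Fin N) (Fin N) ℂ) :
    ∫ g, (oneLinkWeight ρ β g : ℂ) * (B * ρ g).trace ∂haarProbability G = (B * oneLinkMatrix ρ β).trace := by
  have h1 : ∀ g, (oneLinkWeight ρ β g : ℂ) * (B * ρ g).trace =
      ∑ i, ∑ j, B i j * ((oneLinkWeight ρ β g : ℂ) * ρ g j i) := fun g => by
    simp only [Matrix.trace, Matrix.diag_apply, Matrix.mul_apply, Finset.mul_sum]
    exact Finset.sum_congr rfl fun i _ => Finset.sum_congr rfl fun j _ => by ring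
  simp_rw [h1]
  rw [integral_finsetSum _ fun i _ => integrable_finsetSum _ fun j _ =>
    (integrable_oneLinkWeight_mul_entry ρ hρ β j i).const_mul _]
  simp only [Matrix.trace, Matrix.diag_apply, Matrix.mul_apply, oneLinkMatrix_apply]
  refine Finset.sum_congr rfl fun i _ => ?_
  rw [integral_finsetSum _ fun j _ => (integrable_oneLinkWeight_mul_entry ρ hρ β j i).const_mul _]
  exact Finset.sum_congr rfl fun j _ => integral_const_mul _ _

/-- **The link carrying a group element**: `∫ f_β(a x⁻¹) ρ(x)_{ij} dx = (M(β) ρ(a))_{ij}` (substitute `x = y a`; right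
invariance of Haar measure on the compact group; `f_β(y⁻¹) = f_β(y)`).
[cite: MontvayMunster1994, §3.2.8 (3.184)–(3.187)] -/
theorem integral_oneLinkWeight_mul_inv_mul_rep_apply (hρ : Continuous ρ) (β : ℝ) (a : G) (i j : Fin N) :
    ∫ x, (oneLinkWeight ρ β (a * x⁻¹) : ℂ) * ρ x i j ∂haarProbability G = (oneLinkMatrix ρ β * ρ a) i j := by
  rw [← integral_mul_right_eq_self (fun x => (oneLinkWeight ρ β (a * x⁻¹) : ℂ) * ρ x i j) a]
  have h2 : ∀ y : G, (oneLinkWeight ρ β (a * (y * a)⁻¹) : ℂ) * ρ (y * a) i j =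
      ∑ l, ((oneLinkWeight ρ β y : ℂ) * ρ y i l) * ρ a l j := fun y => by
    rw [mul_inv_rev, ← mul_assoc, mul_inv_cancel, one_mul, oneLinkWeight_inv ρ hρ, map_mul, Matrix.mul_apply,
      Finset.mul_sum]
    exact Finset.sum_congr rfl fun l _ => by ring
  simp_rw [h2]
  rw [integral_finsetSum _ fun l _ => (integrable_oneLinkWeight_mul_entry ρ hρ β i l).mul_const _, Matrix.mul_apply]
  refine Finset.sum_congr rfl fun l _ => ?_
  rw [integral_mul_const, oneLinkMatrix_apply]

/-- ★ **For `β > 0` and `N ≥ 1`, `g ↦ tr(M(β)^n ρ(g))` is not identically zero, for every `n`.**  Even `n = 2k`: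
at `g = 1` it is `tr M^{2k} = ‖M^k‖_F² > 0` (`M` Hermitian and non-zero); odd `n`: its `f_β`-average is
`tr(M^n M) = tr M^{n+1} > 0` (`integral_oneLinkWeight_mul_trace_mul_rep`), so it cannot vanish identically.  This is
what makes a Polyakov loop of every length create a NON-ZERO state of unit electric flux.
[cite: MontvayMunster1994, §3.2.8 (3.185)–(3.187)] [cite: tHooft1979Flux, §4 (4.6)–(4.10)] -/
theorem exists_trace_oneLinkMatrix_pow_mul_rep_ne_zero (hρ : Continuous ρ)
    (hρu : ∀ g, ρ g ∈ Matrix.unitaryGroup (Fin N) ℂ) [NeZero N] {β : ℝ} (hβ : 0 < β) (n : ℕ) :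
    ∃ g : G, ((oneLinkMatrix ρ β) ^ n * ρ g).trace ≠ 0 := by
  have hH : (oneLinkMatrix ρ β).IsHermitian := isHermitian_oneLinkMatrix ρ hρ hρu β
  have hM0 : oneLinkMatrix ρ β ≠ 0 := oneLinkMatrix_ne_zero ρ hρ hρu hβ
  rcases Nat.even_or_odd n with ⟨k, hk⟩ | ⟨k, hk⟩
  · refine ⟨1, fun h0 => ?_⟩
    rw [map_one, mul_one, hk, ← two_mul] at h0
    have h1 := (re_trace_pow_two_mul_pos hH hM0 k).1
    rw [h0, Complex.zero_re] at h1
    exact lt_irrefl _ h1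
  · by_contra hall
    push Not at hall
    have hint := integral_oneLinkWeight_mul_trace_mul_rep ρ hρ β ((oneLinkMatrix ρ β) ^ n)
    have h0 : ∫ g, (oneLinkWeight ρ β g : ℂ) * ((oneLinkMatrix ρ β) ^ n * ρ g).trace ∂haarProbability G = 0 := by
      simp_rw [hall, mul_zero]
      exact integral_zero _ _
    rw [h0, ← pow_succ, hk, show 2 * k + 1 + 1 = 2 * (k + 1) by ring] at hint
    have h1 := (re_trace_pow_two_mul_pos hH hM0 (k + 1)).1
    rw [← hint, Complex.zero_re] at h1
    exact lt_irrefl _ h1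

end Literature.MathematicalPhysics.QuantumFieldTheory

end
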